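import Summits.QuantumFields.YangMills.Theorems.UnitScaleTiltProp7FlatInteriorGradient
import HarnessLib

/-!
# (G1-0′)-flat FILE C — the interior gradient estimate on `ℤ^d` for the massive equation WITH A BOUNDED SOURCE (superposition)

Cell ym3-torus, crux `stmt-QuantumFields-19200` (`MinimiserStabilityRegPr`), post-S45 face (L3′b)-GRAD, row (G1-3)'s REMAINDER SLOT (px12 g15 05:33:38Z
LOCATE NOTE, option (i); ★p1 g25's cut).  Width seat `ym-ust-19200-w5` g14.  THEOREMS ONLY (0 `def`, 0 `sorry`, default heartbeats);
`--supports stmt-QuantumFields-19200 --as helper`; count-neutral.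

WHAT.  The tree holds two flat interior `C^{1,½}` estimates on `ℤ^d`, uniform in the scale `K`: ✓lit
`B4Eq19LatticeInteriorGradient.exists_interior_gradient_const` for `(−Δ + K⁻²)u = ∂*g` with `g` `½`-Hölder at scale `K` (`|∂u(a)| ≤ C(M_u∕K + H)`), and
✓`Prop7FlatInteriorGradient.exists_interior_gradient_const_bounded` for `−Δu = f` with `|f| ≤ F` (`|∂u(a)| ≤ C(M_u∕K + K·F)`).  The covariant-to-flat
comparison ✓p762644 `Prop7TwoBackgroundGradientComparison.two_background_gradient_comparison` produces the MIXED equation `(−Δ + K⁻²)u = ∂*g + f`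
(divergence-form datum `g` AND an `L^∞` remainder `f`).  This file proves the mixed estimate
  ★★ `exists_interior_gradient_const_sourced`: `|∂_μu(a)| ≤ C_d(M_u∕K + H + K·F)` and `|∂_μu(x′) − ∂_μu(a)| ≤ C_d(M_u∕K + H + K·F)√(ρ₀∕K)` (`x′ ∈ Q_{ρ₀}(a)`, `1 ≤ ρ₀ ≤ K`)
by SUPERPOSITION, with no new Campanato iteration: let `w` solve the massive DIRICHLET problem `(−Δ + K⁻²)w = f` on `Q_{4K}(a)`, `w = 0` outside
(✓lit `B4Eq19LatticeDirichletReplacement.exists_dirichlet`); the DISCRETE MAXIMUM PRINCIPLE (§1, `dirichlet_abs_le`: at a positive interior maximum every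
neighbour is smaller — inside by maximality, outside because `w = 0` — so `K⁻²·w ≤ f ≤ F`) gives `|w| ≤ K²F`; then `u − w` solves the pure divergence-form
equation with `|u − w| ≤ M_u + K²F` (first lemma: `C₁(M_u∕K + K·F + H)`), and `w` solves the MASSLESS `−Δw = f − K⁻²w` with `|f − K⁻²w| ≤ 2F` (second lemma:
`C₂(K²F∕K + 2K·F) = 3C₂·K·F`); add (`C = C₁ + 3C₂`).  In η-units (`η = K⁻¹ = ℓ⁻¹`, `Δ^η = K²Δ`, `∇^η = K∂`, `∂^{η*} = K∂*`): for `(Δ^η + 1)u = ∇^{η*}g + r`,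
`‖∇^ηu‖_∞ ≤ C(‖u‖_∞ + H_g + ‖r‖_∞)` — px12's option (i) «a flat interior gradient lemma WITH a bounded source, `ℓ‖∇_1u(x)‖ ≤ C(M_u + H_g + M_r)`».

HONEST.  [folklore] lattice elliptic bookkeeping (Giaquinta Ch. III) on two LANDED estimates; the constant is not tracked beyond `C₁ + 3C₂`.  Nothing of
(G1-3)'s knit, (★) at the member, the ten print rows, `hT`, `hGF`, EX or 19200 is proved here; rung R3 = SU(2) YM₃ on T³ — NOT d = 4, NOT infinite
volume, NOT a mass gap, NOT Clay.
-/

noncomputable section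

set_option autoImplicit false

open scoped BigOperators
open Finset

namespace Summit.QuantumFields.YangMills.Theorems.Prop7FlatInteriorGradientSourced

open Literature.MathematicalPhysics.QuantumFieldTheory.Balaban1983to89
open B4Eq19LatticeOperators (Zd unitVec box mem_box lop dvg fdiff fdiff_apply lop_apply fdiff_sub lop_sub lop_const_mul)
open B4Eq19LatticeDirichletReplacement (exists_dirichlet)
open B4Eq19LatticeInteriorGradient (exists_interior_gradient_const)
open Summit.QuantumFields.YangMills.Theorems.Prop7FlatInteriorGradient (exists_interior_gradient_const_bounded)

variable {d : ℕ}

/-! ## §1 The discrete maximum principle for the massive Dirichlet problem on a box -/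

/-- **ONE-SIDED DISCRETE MAXIMUM PRINCIPLE** (`κ > 0`): if `w = 0` off the box `Q_r(z)`, `(−Δ + κ)w = f` on `Q_r(z)` and `f ≤ F` there (`F ≥ 0`), then `w ≤ F∕κ`
everywhere (at a maximiser `y₀` of `w` on the box with `w y₀ > 0`, every lattice neighbour has `w ≤ w y₀` — in the box by maximality, outside since `w = 0` — so
`κ·w y₀ ≤ (−Δ + κ)w(y₀) = f y₀ ≤ F`). [folklore] [cite: Giaquinta1984, Ch. III §2 p.78] -/
theorem dirichlet_le {κ : ℝ} (hκ : 0 < κ) {z : Zd d} {r : ℤ} {w f : Zd d → ℝ} {F : ℝ} (hF : 0 ≤ F)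
    (hw0 : ∀ y ∉ box z r, w y = 0) (hw : ∀ y ∈ box z r, lop κ w y = f y) (hf : ∀ y ∈ box z r, f y ≤ F) :
    ∀ y, w y ≤ F / κ := by
  classical
  have hFκ : 0 ≤ F / κ := div_nonneg hF hκ.le
  by_cases hne : (box z r).Nonempty
  · obtain ⟨y₀, hy₀, hmax⟩ := Finset.exists_max_image (box z r) w hne
    -- every value of `w` is `≤ max (w y₀) 0`
    have hle : ∀ y, w y ≤ max (w y₀) 0 := fun y => by
      by_cases hy : y ∈ box z r
      · exact (hmax y hy).trans (le_max_left _ _)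
      · rw [hw0 y hy]; exact le_max_right _ _
    have hkey : w y₀ ≤ F / κ := by
      rcases le_or_gt (w y₀) 0 with hpos | hpos
      · exact hpos.trans hFκ
      · have hnb : ∀ y, w y ≤ w y₀ := fun y => (hle y).trans (by rw [max_eq_left hpos.le])
        have h1 : κ * w y₀ ≤ lop κ w y₀ := by
          rw [lop_apply]
          have : 0 ≤ ∑ μ, (2 * w y₀ - w (y₀ + unitVec μ) - w (y₀ - unitVec μ)) :=
            Finset.sum_nonneg fun μ _ => by linarith [hnb (y₀ + unitVec μ), hnb (y₀ - unitVec μ)]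
          linarith
        rw [hw y₀ hy₀] at h1
        rw [le_div_iff₀ hκ, mul_comm]
        exact h1.trans (hf y₀ hy₀)
    intro y
    rcases le_total (w y₀) 0 with h | h
    · exact (hle y).trans (by rw [max_eq_right h]; exact hFκ)
    · exact (hle y).trans (by rw [max_eq_left h]; exact hkey)
  · intro y
    have hy : y ∉ box z r := fun h => hne ⟨y, h⟩
    rw [hw0 y hy]; exact hFκ

/-- **DISCRETE MAXIMUM PRINCIPLE FOR THE MASSIVE DIRICHLET PROBLEM ON A BOX** (`κ > 0`): `w = 0` off `Q_r(z)`, `(−Δ + κ)w = f` on `Q_r(z)`, `|f| ≤ F` there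
(`F ≥ 0`) ⟹ `|w| ≤ F∕κ` everywhere (✓`dirichlet_le` for `w` and for `−w`). [folklore] [cite: Giaquinta1984, Ch. III §2 p.78] -/
theorem dirichlet_abs_le {κ : ℝ} (hκ : 0 < κ) {z : Zd d} {r : ℤ} {w f : Zd d → ℝ} {F : ℝ} (hF : 0 ≤ F)
    (hw0 : ∀ y ∉ box z r, w y = 0) (hw : ∀ y ∈ box z r, lop κ w y = f y) (hf : ∀ y ∈ box z r, |f y| ≤ F) :
    ∀ y, |w y| ≤ F / κ := by
  intro y
  rw [abs_le]
  constructor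
  · have h := dirichlet_le hκ hF (w := fun x => -1 * w x) (f := fun x => -1 * f x)
      (fun y hy => by simp only [hw0 y hy, mul_zero]) (fun y hy => by rw [lop_const_mul, hw y hy])
      (fun y hy => by have := hf y hy; rw [abs_le] at this; linarith) y
    simp only [neg_mul, one_mul] at h
    linarith
  · exact dirichlet_le hκ hF hw0 hw (fun y hy => (le_abs_self _).trans (hf y hy)) y

/-! ## §2 ★★ The interior gradient estimate for `(−Δ + K⁻²)u = ∂*g + f` -/

/-- ★★ **THE INTERIOR GRADIENT (`C^{1,½}`) ESTIMATE ON `ℤ^d` FOR THE MASSIVE EQUATION WITH DIVERGENCE-FORM HÖLDER DATA AND A BOUNDED SOURCE, UNIFORM IN THE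
SCALE.**  There is `C_d ≥ 0` such that for every `K ≥ 3`, every `u, g, f` with `(−Δ + K⁻²)u = ∂*g + f` on `Q_{4K}(a)`, `|u| ≤ M_u` and `|f| ≤ F` on `Q_{4K}(a)`,
`g` `½`-Hölder at scale `K` on `Q_{4K}(a)` with constant `H` (`|g(y′,μ) − g(y,μ)| ≤ H√(s∕K)`, `y′ ∈ Q_s(y)`), and every direction `μ`:
`|∂_μu(a)| ≤ C_d(M_u∕K + H + K·F)` and `|∂_μu(x′) − ∂_μu(a)| ≤ C_d(M_u∕K + H + K·F)√(ρ₀∕K)` for `x′ ∈ Q_{ρ₀}(a)`, `1 ≤ ρ₀ ≤ K`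
(superposition: the Dirichlet corrector `w` of ✓`exists_dirichlet` with `|w| ≤ K²F` by ✓`dirichlet_abs_le`; ✓`exists_interior_gradient_const` on `u − w`;
✓`exists_interior_gradient_const_bounded` on `w` with the massless right side `f − K⁻²w`; `C_d = C₁ + 3C₂`).  In η-units (`η = K⁻¹`):
`‖∇^ηu‖_∞, [∇^ηu]_{½,η} ≤ C_d(‖u‖_∞ + H_g + ‖r‖_∞)` for `(Δ^η + 1)u = ∇^{η*}g + r`.
[folklore] [cite: Giaquinta1984, Ch. III §3 Thm 3.1–3.2 pp.84–88, §2 p.78; Balaban1984PropagatorsII, (1.9) p.226; Balaban1985BackgroundPropagators, Thm 3.1 (3.43)–(3.44) p.398] -/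
theorem exists_interior_gradient_const_sourced (d : ℕ) (hd : 1 ≤ d) : ∃ C : ℝ, 0 ≤ C ∧
    ∀ (K : ℕ), 3 ≤ K → ∀ (u : Zd d → ℝ) (g : Zd d → Fin d → ℝ) (f : Zd d → ℝ) (a : Zd d) (Mu H F : ℝ), 0 ≤ Mu → 0 ≤ H → 0 ≤ F →
      (∀ y ∈ box a (4 * K), lop (1 / (K : ℝ) ^ 2) u y = dvg g y + f y) →
      (∀ y ∈ box a (4 * K), |u y| ≤ Mu) →
      (∀ (s : ℕ) (y y' : Zd d), y ∈ box a (4 * K) → y' ∈ box a (4 * K) → y' ∈ box y s → ∀ μ, |g y' μ - g y μ| ≤ H * Real.sqrt (s / K)) →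
      (∀ y ∈ box a (4 * K), |f y| ≤ F) →
      ∀ μ : Fin d, |fdiff μ u a| ≤ C * (Mu / K + H + K * F) ∧
        ∀ (x' : Zd d) (ρ₀ : ℕ), 1 ≤ ρ₀ → ρ₀ ≤ K → x' ∈ box a (ρ₀ : ℤ) →
          |fdiff μ u x' - fdiff μ u a| ≤ C * (Mu / K + H + K * F) * Real.sqrt ((ρ₀ : ℝ) / K) := by
  obtain ⟨C₁, hC₁, h₁⟩ := exists_interior_gradient_const d hd
  obtain ⟨C₂, hC₂, h₂⟩ := exists_interior_gradient_const_bounded d hd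
  refine ⟨C₁ + 3 * C₂, by positivity, ?_⟩
  intro K hK u g f a Mu H F hMu hH hF hEq hu hg hf μ
  have hK0 : (0 : ℝ) < K := by exact_mod_cast (show 0 < K by omega)
  have hκ0 : (0 : ℝ) < 1 / (K : ℝ) ^ 2 := by positivity
  -- the Dirichlet corrector `w` and its maximum-principle bound
  obtain ⟨w, hw0, hw⟩ := exists_dirichlet hκ0 a (4 * (K : ℤ)) f
  have hFκ : F / (1 / (K : ℝ) ^ 2) = (K : ℝ) ^ 2 * F := by field_simp
  have hwabs : ∀ y, |w y| ≤ (K : ℝ) ^ 2 * F := fun y => by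
    have := dirichlet_abs_le hκ0 hF hw0 hw hf y; rwa [hFκ] at this
  -- `v := u − w` solves the pure divergence-form equation
  set v : Zd d → ℝ := fun x => u x - w x with hv
  have hvEq : ∀ y ∈ box a (4 * (K : ℤ)), lop (1 / (K : ℝ) ^ 2) v y = dvg g y := by
    intro y hy; rw [hv, lop_sub, hEq y hy, hw y hy]; ring
  have hvb : ∀ y ∈ box a (4 * (K : ℤ)), |v y| ≤ Mu + (K : ℝ) ^ 2 * F := by
    intro y hy
    exact (abs_sub _ _).trans (add_le_add (hu y hy) (hwabs y))
  have H1 := h₁ K hK v g a (Mu + (K : ℝ) ^ 2 * F) H (by positivity) hH hvEq hvb hg μ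
  -- `w` solves the massless equation with the bounded right side `f − K⁻²w`
  set f₂ : Zd d → ℝ := fun y => f y - 1 / (K : ℝ) ^ 2 * w y with hf₂
  have hwEq : ∀ y ∈ box a (4 * (K : ℤ)), lop 0 w y = f₂ y := by
    intro y hy; rw [hf₂]; dsimp only; rw [← hw y hy, lop_apply, lop_apply]; ring
  have hwb : ∀ y ∈ box a (4 * (K : ℤ)), |w y| ≤ (K : ℝ) ^ 2 * F := fun y _ => hwabs y
  have hf₂b : ∀ y ∈ box a (4 * (K : ℤ)), |f₂ y| ≤ 2 * F := by
    intro y hy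
    have h1 : |1 / (K : ℝ) ^ 2 * w y| ≤ F := by
      rw [abs_mul, abs_of_pos hκ0]
      have := mul_le_mul_of_nonneg_left (hwabs y) hκ0.le
      have e : 1 / (K : ℝ) ^ 2 * ((K : ℝ) ^ 2 * F) = F := by field_simp
      linarith [e]
    exact (abs_sub _ _).trans (by linarith [hf y hy])
  have H2 := h₂ K hK w f₂ a ((K : ℝ) ^ 2 * F) (2 * F) (by positivity) (by positivity) hwEq hwb hf₂b μ
  -- combine
  have euv : ∀ y, fdiff μ u y = fdiff μ v y + fdiff μ w y := fun y => by rw [hv, fdiff_sub]; ring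
  set X : ℝ := Mu / K + H + K * F with hX
  have hX0 : 0 ≤ X := by positivity
  have eKF : (K : ℝ) ^ 2 * F / K = K * F := by rw [pow_two, mul_assoc, mul_div_cancel_left₀ _ hK0.ne']
  have hb1 : C₁ * ((Mu + (K : ℝ) ^ 2 * F) / K + H) = C₁ * X := by rw [hX, add_div, eKF]; ring
  have hb2 : C₂ * ((K : ℝ) ^ 2 * F / K + K * (2 * F)) = 3 * C₂ * (K * F) := by rw [eKF]; ring
  have hKF : (K : ℝ) * F ≤ X := by rw [hX]; linarith [div_nonneg hMu hK0.le]
  have hb2' : C₂ * ((K : ℝ) ^ 2 * F / K + K * (2 * F)) ≤ 3 * C₂ * X := by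
    rw [hb2]; exact mul_le_mul_of_nonneg_left hKF (by positivity)
  refine ⟨?_, fun x' ρ₀ hρ1 hρK hx' => ?_⟩
  · have g1 := H1.1
    rw [hb1] at g1
    rw [euv]
    calc |fdiff μ v a + fdiff μ w a| ≤ |fdiff μ v a| + |fdiff μ w a| := abs_add_le _ _
      _ ≤ C₁ * X + 3 * C₂ * X := add_le_add g1 (H2.1.trans hb2')
      _ = (C₁ + 3 * C₂) * X := by ring
  · have hρ0 : 0 ≤ Real.sqrt ((ρ₀ : ℝ) / K) := Real.sqrt_nonneg _
    have g1 := H1.2 x' ρ₀ hρ1 hρK hx'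
    rw [hb1] at g1
    have g2 := (H2.2 x' ρ₀ hρ1 hρK hx').trans (mul_le_mul_of_nonneg_right hb2' hρ0)
    rw [euv, euv]
    have e : fdiff μ v x' + fdiff μ w x' - (fdiff μ v a + fdiff μ w a) =
        (fdiff μ v x' - fdiff μ v a) + (fdiff μ w x' - fdiff μ w a) := by ring
    rw [e]
    calc |fdiff μ v x' - fdiff μ v a + (fdiff μ w x' - fdiff μ w a)|
        ≤ |fdiff μ v x' - fdiff μ v a| + |fdiff μ w x' - fdiff μ w a| := abs_add_le _ _
      _ ≤ C₁ * X * Real.sqrt ((ρ₀ : ℝ) / K) + 3 * C₂ * X * Real.sqrt ((ρ₀ : ℝ) / K) := add_le_add g1 g2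
      _ = (C₁ + 3 * C₂) * X * Real.sqrt ((ρ₀ : ℝ) / K) := by ring

end Summit.QuantumFields.YangMills.Theorems.Prop7FlatInteriorGradientSourced

end
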